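import Literature.Computability.Cryptography.CubicClassPost
import Mathlib.Algebra.Order.Round
import Mathlib.Data.Rat.Lemmas
import HarnessLib

/-!
# The class-group stage: exact recovery of a character combination from an accurate pair of Fourier samples

Topic `Computability/Cryptography`; theorem file about the definitions of `CubicClassPost.lean` (the classical
post-processor of the class-group stage of the crux `LinnikCubicClassGroups.PureCubicClassGroupFBQP`, line
`arakelov-giant-step-cycle`; consumer: the proof of `CubicClassSampling.ClaimPost`). No definitions, no named facts.

An ACCURATE unit outcome decodes (`PostParams.decodeUnit`) to a signed residue `kk`, `|kk| ≤ K₀`, and digit angles `φ_t` with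
`φ_t ≡ ξ_t + kk μ_t + O(δ) (mod 1)` for a character `ξ ∈ ((1/h)ℤ/ℤ)^T` and an UNKNOWN real coupling `μ`. For a pair of accurate
outcomes the reduced coefficients `c = coefs u₁ u₂` (`c₁ kk₁ + c₂ kk₂ = 0`, `gcd = 1`, `|c₁| + |c₂| ≤ 2K₀ + 1`) kill `μ` EXACTLY:
`c₁ φ₁ + c₂ φ₂ ≡ c₁ ξ₁ + c₂ ξ₂ + O((2K₀+1)δ)`, and when `(4K₀+2) δ B² < 1` the bounded-denominator rounding `roundB` returns the
fraction `c₁ ξ₁ + c₂ ξ₂ (mod ℤ)` itself (denominator `∣ h ≤ B`; two fractions of denominators `≤ B` closer than `1/B²` coincide):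

* `exists_near_int_comb` (integer combinations of near-integers); `one_div_le_abs_sub_of_ne`, `eq_of_den_le_of_abs_sub_lt`,
  **`roundB_eq`** (the rounding is exact near a fraction of denominator `≤ B`); `den_dvd_of_mul_eq_int`;
* `abs_le_of_decodeUnit_eq_some` (`|kk| ≤ K₀`); `coefs_mul_add_mul`, `gcd_coefs`, `abs_coefs_le` (the reduced coefficients);
* **`exists_deriveR_eq`** — on an accurate pair, `deriveR u₁ u₂ t = c₁ ξ₁,t + c₂ ξ₂,t + (integer)`.
[Hallgren 2005, §4; Kitaev 1995, §4]

## References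

* S. Hallgren, STOC 2005, §4. [Hallgren2005]
* A. Yu. Kitaev, arXiv:quant-ph/9511026 (1995), §4. [Kitaev1995]
-/

noncomputable section

namespace Literature.Computability.Cryptography

namespace CubicClassPost

open Finset

/-! ### Near-integers and fractions with bounded denominators -/

/-- **Integer combinations of near-integers are near-integers**: if `x_i` is within `δ_i` of `ℤ` then `c₁ x₁ + c₂ x₂` is within
`|c₁| δ₁ + |c₂| δ₂` of `ℤ`. [folklore] -/
theorem exists_near_int_comb {x₁ x₂ δ₁ δ₂ : ℝ} (c₁ c₂ : ℤ) (h₁ : ∃ m : ℤ, |x₁ - m| ≤ δ₁) (h₂ : ∃ m : ℤ, |x₂ - m| ≤ δ₂) :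
    ∃ m : ℤ, |c₁ * x₁ + c₂ * x₂ - m| ≤ |(c₁ : ℝ)| * δ₁ + |(c₂ : ℝ)| * δ₂ := by
  obtain ⟨m₁, hm₁⟩ := h₁
  obtain ⟨m₂, hm₂⟩ := h₂
  refine ⟨c₁ * m₁ + c₂ * m₂, ?_⟩
  calc |c₁ * x₁ + c₂ * x₂ - ((c₁ * m₁ + c₂ * m₂ : ℤ) : ℝ)| = |c₁ * (x₁ - m₁) + c₂ * (x₂ - m₂)| := by
        push_cast; ring_nf
    _ ≤ |c₁ * (x₁ - m₁)| + |c₂ * (x₂ - m₂)| := abs_add_le _ _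
    _ = |(c₁ : ℝ)| * |x₁ - m₁| + |(c₂ : ℝ)| * |x₂ - m₂| := by rw [abs_mul, abs_mul]
    _ ≤ |(c₁ : ℝ)| * δ₁ + |(c₂ : ℝ)| * δ₂ := by gcongr

/-- **Distinct fractions are far apart**: `|r − r'| ≥ 1/(den r · den r')` for `r ≠ r'`. [folklore] -/
theorem one_div_le_abs_sub_of_ne {r r' : ℚ} (h : r ≠ r') : (1 : ℚ) / (r.den * r'.den) ≤ |r - r'| := by
  have hd : (0 : ℚ) < r.den * r'.den := by positivity
  rw [div_le_iff₀ hd]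
  have key : (r - r') * (r.den * r'.den) = ((r.num * r'.den - r'.num * r.den : ℤ) : ℚ) := by
    push_cast
    calc (r - r') * (r.den * r'.den) = (r * r.den) * r'.den - (r' * r'.den) * r.den := by ring
      _ = r.num * r'.den - r'.num * r.den := by rw [Rat.mul_den_eq_num, Rat.mul_den_eq_num]
  have hne : (r.num * r'.den - r'.num * r.den : ℤ) ≠ 0 := by
    intro h0
    apply h
    have h2 : (r - r') * (r.den * r'.den) = 0 := by rw [key, h0, Int.cast_zero]
    rcases mul_eq_zero.1 h2 with h3 | h3
    · linarith
    · exact absurd h3 hd.ne'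
  calc (1 : ℚ) ≤ |((r.num * r'.den - r'.num * r.den : ℤ) : ℚ)| := by
        rw [← Int.cast_abs]; exact_mod_cast Int.one_le_abs hne
    _ = |r - r'| * (r.den * r'.den) := by rw [← key, abs_mul, abs_of_pos hd]

/-- **Uniqueness of bounded-denominator approximation**: two fractions of denominators `≤ B` closer than `1/B²` are equal.
[cite: Kitaev1995, §4] -/
theorem eq_of_den_le_of_abs_sub_lt {B : ℕ} {r r' : ℚ} (hr : r.den ≤ B) (hr' : r'.den ≤ B)
    (h : |r - r'| < 1 / (B : ℚ) ^ 2) : r = r' := by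
  by_contra hne
  have h1 := one_div_le_abs_sub_of_ne hne
  have hB : (r.den * r'.den : ℚ) ≤ (B : ℚ) ^ 2 := by rw [sq]; exact_mod_cast Nat.mul_le_mul hr hr'
  have hd : (0 : ℚ) < r.den * r'.den := by positivity
  have : (1 : ℚ) / (B : ℚ) ^ 2 ≤ 1 / (r.den * r'.den) := one_div_le_one_div_of_le hd hB
  linarith

/-- **The bounded-denominator rounding is exact**: if `r` has denominator `≤ B` and `|x − r| < 1/(2B²)` then `roundB B x = r`.
[cite: Kitaev1995, §4] -/
theorem roundB_eq {B : ℕ} {x r : ℚ} (hr : r.den ≤ B) (hx : |x - r| < 1 / (2 * (B : ℚ) ^ 2)) : roundB B x = r := by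
  have hex : ∃ r : ℚ, r.den ≤ B ∧ |x - r| < 1 / (2 * (B : ℚ) ^ 2) := ⟨r, hr, hx⟩
  rw [roundB, dif_pos hex]
  obtain ⟨h1, h2⟩ := Classical.choose_spec hex
  apply eq_of_den_le_of_abs_sub_lt h1 hr
  calc |Classical.choose hex - r| ≤ |Classical.choose hex - x| + |x - r| := abs_sub_le _ _ _
    _ < 1 / (2 * (B : ℚ) ^ 2) + 1 / (2 * (B : ℚ) ^ 2) := by rw [abs_sub_comm]; exact add_lt_add h2 hx
    _ = 1 / (B : ℚ) ^ 2 := by ring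

/-- A rational `x` with `x h ∈ ℤ` has denominator dividing `h`. [folklore] -/
theorem den_dvd_of_mul_eq_int {x : ℚ} {h : ℕ} (hh : h ≠ 0) (hz : ∃ z : ℤ, x * h = z) : x.den ∣ h := by
  obtain ⟨z, hz⟩ := hz
  have hx : x = Rat.divInt z h := by
    rw [Rat.divInt_eq_div, eq_div_iff (by exact_mod_cast hh : ((h : ℤ) : ℚ) ≠ 0), ← hz]
    push_cast; rfl
  have := Rat.den_dvd z h
  rw [← hx] at this
  exact_mod_cast this

/-! ### The decoded residue and the reduced coefficients -/

variable (P : PostParams)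

/-- **The slice window**: a decoded residue satisfies `|kk| ≤ K₀`. [cite: Hallgren2005, §4] -/
theorem abs_le_of_decodeUnit_eq_some {c : ℕ} {kk : ℤ} {ν : ℕ} (h : P.decodeUnit c = some (kk, ν)) : |kk| ≤ P.K₀ := by
  simp only [PostParams.decodeUnit] at h
  split_ifs at h with h1 h2 h3
  · simp only [Option.some.injEq, Prod.mk.injEq] at h
    rw [← h.1, abs_le]
    constructor <;> linarith [(Nat.cast_nonneg _ : (0 : ℤ) ≤ ((c / 2 ^ P.top / 2 ^ P.aexp % 2 ^ P.s : ℕ) : ℤ)),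
      (by exact_mod_cast h2 : ((c / 2 ^ P.top / 2 ^ P.aexp % 2 ^ P.s : ℕ) : ℤ) ≤ P.K₀)]
  · simp only [Option.some.injEq, Prod.mk.injEq] at h
    rw [← h.1, abs_le]
    have hlt : c / 2 ^ P.top / 2 ^ P.aexp % 2 ^ P.s < 2 ^ P.s := Nat.mod_lt _ (Nat.two_pow_pos _)
    have h3' : 2 ^ P.s ≤ c / 2 ^ P.top / 2 ^ P.aexp % 2 ^ P.s + P.K₀ := by omega
    have hA : ((c / 2 ^ P.top / 2 ^ P.aexp % 2 ^ P.s : ℕ) : ℤ) < ((2 ^ P.s : ℕ) : ℤ) := by exact_mod_cast hlt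
    have hB : ((2 ^ P.s : ℕ) : ℤ) ≤ ((c / 2 ^ P.top / 2 ^ P.aexp % 2 ^ P.s : ℕ) : ℤ) + P.K₀ := by exact_mod_cast h3'
    constructor <;> omega

/-- **The reduced coefficients kill the residues**: `c₁ kk₁ + c₂ kk₂ = 0`. [cite: Hallgren2005, §4] -/
theorem coefs_mul_add_mul (u₁ u₂ : ℤ × ℕ) :
    (PostParams.coefs u₁ u₂).1 * u₁.1 + (PostParams.coefs u₁ u₂).2 * u₂.1 = 0 := by
  unfold PostParams.coefs
  by_cases h0 : u₁.1 = 0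
  · rw [if_pos h0, h0]; ring
  · rw [if_neg h0]
    simp only
    have ha := Int.ediv_mul_cancel (Int.gcd_dvd_left u₁.1 u₂.1)
    have hb := Int.ediv_mul_cancel (Int.gcd_dvd_right u₁.1 u₂.1)
    set g : ℤ := (Int.gcd u₁.1 u₂.1 : ℤ)
    calc u₂.1 / g * u₁.1 + -(u₁.1 / g) * u₂.1 = u₂.1 / g * (u₁.1 / g * g) - u₁.1 / g * (u₂.1 / g * g) := by
          rw [ha, hb]; ring
      _ = 0 := by ring

/-- **The reduced coefficients are coprime.** [cite: Hallgren2005, §4] -/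
theorem gcd_coefs (u₁ u₂ : ℤ × ℕ) : Int.gcd (PostParams.coefs u₁ u₂).1 (PostParams.coefs u₁ u₂).2 = 1 := by
  unfold PostParams.coefs
  by_cases h0 : u₁.1 = 0
  · rw [if_pos h0]; rfl
  · rw [if_neg h0]
    simp only
    rw [Int.gcd_neg, Int.gcd_comm]
    exact Int.gcd_div_gcd_div_gcd (Int.gcd_pos_of_ne_zero_left _ h0)

/-- **The reduced coefficients are small**: `|c₁| ≤ max |kk₂| 1` and `|c₂| ≤ |kk₁|`. [cite: Hallgren2005, §4] -/
theorem abs_coefs_le (u₁ u₂ : ℤ × ℕ) :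
    |(PostParams.coefs u₁ u₂).1| ≤ |u₂.1| ⊔ 1 ∧ |(PostParams.coefs u₁ u₂).2| ≤ |u₁.1| := by
  unfold PostParams.coefs
  by_cases h0 : u₁.1 = 0
  · rw [if_pos h0]
    exact ⟨by simp, by simp⟩
  · rw [if_neg h0]
    simp only [abs_neg]
    have h1 : |u₂.1 / (Int.gcd u₁.1 u₂.1 : ℤ)| ≤ |u₂.1| := by
      rw [Int.abs_eq_natAbs, Int.abs_eq_natAbs]; exact_mod_cast Int.natAbs_ediv_le_natAbs _ _
    have h2 : |u₁.1 / (Int.gcd u₁.1 u₂.1 : ℤ)| ≤ |u₁.1| := by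
      rw [Int.abs_eq_natAbs, Int.abs_eq_natAbs]; exact_mod_cast Int.natAbs_ediv_le_natAbs _ _
    exact ⟨h1.trans (le_max_left _ _), h2⟩

/-! ### Exact recovery on an accurate pair -/

/-- **Exact recovery** (the pairing kills the unknown coupling; the rounding is exact): if `u_i = (kk_i, ν_i)` are decoded
outcomes, `|kk_i| ≤ K₀`, whose digit angles satisfy `φ_{i,t} ≡ ξ_{i,t} + kk_i μ_t (mod 1)` up to `δ` for vectors `ξ_i` with
`h ξ_i ∈ ℤ^T`, `1 ≤ h ≤ B`, and `(4K₀+2) δ B² < 1`, then for every coordinate `t`,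
`deriveR u₁ u₂ t = c₁ ξ_{1,t} + c₂ ξ_{2,t} + (an integer)` with `c = coefs u₁ u₂`. [cite: Hallgren2005, §4; Kitaev1995, §4] -/
theorem exists_deriveR_eq {μ : Fin P.T → ℝ} {δ : ℝ} {u₁ u₂ : ℤ × ℕ} {ξ₁ ξ₂ : Fin P.T → ℚ} {h : ℕ}
    (h1 : 1 ≤ h) (hhB : h ≤ P.B) (hδ : 0 ≤ δ) (hδK : (4 * (P.K₀ : ℝ) + 2) * δ * (P.B : ℝ) ^ 2 < 1)
    (hd₁ : ∀ t, ∃ z : ℤ, ξ₁ t * h = z) (hd₂ : ∀ t, ∃ z : ℤ, ξ₂ t * h = z)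
    (hk₁ : |u₁.1| ≤ P.K₀) (hk₂ : |u₂.1| ≤ P.K₀)
    (ha₁ : ∀ t : Fin P.T, ∃ m : ℤ, |((P.phi u₁.2 t : ℚ) : ℝ) - (u₁.1 : ℝ) * μ t - (ξ₁ t : ℝ) - m| ≤ δ)
    (ha₂ : ∀ t : Fin P.T, ∃ m : ℤ, |((P.phi u₂.2 t : ℚ) : ℝ) - (u₂.1 : ℝ) * μ t - (ξ₂ t : ℝ) - m| ≤ δ)
    (t : Fin P.T) :
    ∃ m : ℤ, P.deriveR u₁ u₂ t =
      (PostParams.coefs u₁ u₂).1 * ξ₁ t + (PostParams.coefs u₁ u₂).2 * ξ₂ t + m := by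
  have hc0 := coefs_mul_add_mul u₁ u₂
  obtain ⟨hc1, hc2⟩ := abs_coefs_le u₁ u₂
  set c₁ : ℤ := (PostParams.coefs u₁ u₂).1 with hc₁
  set c₂ : ℤ := (PostParams.coefs u₁ u₂).2 with hc₂
  set q : ℚ := (c₁ : ℚ) * P.phi u₁.2 t + (c₂ : ℚ) * P.phi u₂.2 t with hq
  set y : ℚ := (c₁ : ℚ) * ξ₁ t + (c₂ : ℚ) * ξ₂ t with hy
  have hB1 : (1 : ℝ) ≤ P.B := by exact_mod_cast h1.trans hhB
  have hK0 : (0 : ℝ) ≤ P.K₀ := Nat.cast_nonneg _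
  -- Step 1: `q - y` is within `(2K₀+1)δ` of an integer
  obtain ⟨m₀, hm₀⟩ : ∃ m₀ : ℤ, |((q - y : ℚ) : ℝ) - m₀| ≤ (2 * P.K₀ + 1) * δ := by
    obtain ⟨m, hm⟩ := exists_near_int_comb c₁ c₂ (ha₁ t) (ha₂ t)
    refine ⟨m, ?_⟩
    have h0 : (c₁ : ℝ) * u₁.1 + c₂ * u₂.1 = 0 := by exact_mod_cast hc0
    have hlin : (c₁ : ℝ) * (((P.phi u₁.2 t : ℚ) : ℝ) - (u₁.1 : ℝ) * μ t - (ξ₁ t : ℝ)) +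
        c₂ * (((P.phi u₂.2 t : ℚ) : ℝ) - (u₂.1 : ℝ) * μ t - (ξ₂ t : ℝ)) = ((q - y : ℚ) : ℝ) := by
      rw [hq, hy]
      push_cast
      linear_combination (-(μ t)) * h0
    rw [← hlin]
    refine hm.trans ?_
    have hsum : |(c₁ : ℝ)| + |(c₂ : ℝ)| ≤ 2 * P.K₀ + 1 := by
      have e1' : |c₁| ≤ (P.K₀ : ℤ) ⊔ 1 := hc1.trans (sup_le_sup_right hk₂ 1)
      have e1 : |(c₁ : ℝ)| ≤ (P.K₀ : ℝ) ⊔ 1 := by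
        have e := (Int.cast_le (R := ℝ)).2 e1'
        push_cast at e
        exact e
      have e2' : |c₂| ≤ (P.K₀ : ℤ) := hc2.trans hk₁
      have e2 : |(c₂ : ℝ)| ≤ P.K₀ := by
        have e := (Int.cast_le (R := ℝ)).2 e2'
        push_cast at e
        exact e
      have e3 : (P.K₀ : ℝ) ⊔ 1 ≤ P.K₀ + 1 := sup_le (by linarith) (by linarith)
      linarith
    nlinarith [abs_nonneg (c₁ : ℝ), abs_nonneg (c₂ : ℝ)]
  -- Step 2: `(2K₀+1)δ < 1/(2B²)`
  have hsmall : (2 * (P.K₀ : ℝ) + 1) * δ < 1 / (2 * (P.B : ℝ) ^ 2) := by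
    rw [lt_div_iff₀ (by positivity)]
    nlinarith
  -- Step 3: the candidate fraction `r = y + (m₀ - ⌊q⌋)` is `1/(2B²)`-close to `fract q`
  set r : ℚ := y + ((m₀ - ⌊q⌋ : ℤ) : ℚ) with hr
  have hxr : |Int.fract q - r| < 1 / (2 * (P.B : ℚ) ^ 2) := by
    have e : Int.fract q - r = (q - y) - m₀ := by
      rw [Int.fract, hr]; push_cast; ring
    rw [e]
    have : ((|(q - y) - m₀| : ℚ) : ℝ) < ((1 / (2 * (P.B : ℚ) ^ 2) : ℚ) : ℝ) := by
      have h' := lt_of_le_of_lt hm₀ hsmall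
      push_cast at h' ⊢
      exact h'
    exact_mod_cast this
  -- Step 4: its denominator divides `h ≤ B`
  have hrden : r.den ≤ P.B := by
    obtain ⟨z₁, hz₁⟩ := hd₁ t
    obtain ⟨z₂, hz₂⟩ := hd₂ t
    have hdvd : r.den ∣ h := den_dvd_of_mul_eq_int (by omega) ⟨c₁ * z₁ + c₂ * z₂ + (m₀ - ⌊q⌋) * h, by
      rw [hr, hy]; push_cast; rw [← hz₁, ← hz₂]; ring⟩
    exact (Nat.le_of_dvd (by omega) hdvd).trans hhB
  -- Step 5: the rounding returns `r`
  refine ⟨m₀ - ⌊q⌋, ?_⟩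
  rw [PostParams.deriveR, ← hc₁, ← hc₂, ← hq, roundB_eq hrden hxr]

/-- **Exact recovery, uncurried summary form** of `exists_deriveR_eq`. [cite: Hallgren2005, §4; Kitaev1995, §4] -/
theorem deriveR_exact_of_accurate : ∀ (P : CubicClassPost.PostParams) (μ : Fin P.T → ℝ) (δ : ℝ) (u₁ u₂ : ℤ × ℕ)
    (ξ₁ ξ₂ : Fin P.T → ℚ) (h : ℕ), 1 ≤ h → h ≤ P.B → 0 ≤ δ → (4 * (P.K₀ : ℝ) + 2) * δ * (P.B : ℝ) ^ 2 < 1 →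
    (∀ t, ∃ z : ℤ, ξ₁ t * h = z) → (∀ t, ∃ z : ℤ, ξ₂ t * h = z) → |u₁.1| ≤ P.K₀ → |u₂.1| ≤ P.K₀ →
    (∀ t : Fin P.T, ∃ m : ℤ, |((P.phi u₁.2 t : ℚ) : ℝ) - (u₁.1 : ℝ) * μ t - (ξ₁ t : ℝ) - m| ≤ δ) →
    (∀ t : Fin P.T, ∃ m : ℤ, |((P.phi u₂.2 t : ℚ) : ℝ) - (u₂.1 : ℝ) * μ t - (ξ₂ t : ℝ) - m| ≤ δ) →
    ∀ t : Fin P.T, ∃ m : ℤ, P.deriveR u₁ u₂ t =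
      (CubicClassPost.PostParams.coefs u₁ u₂).1 * ξ₁ t + (CubicClassPost.PostParams.coefs u₁ u₂).2 * ξ₂ t + m :=
  fun P _ _ _ _ _ _ _ h1 hhB hδ hδK hd₁ hd₂ hk₁ hk₂ ha₁ ha₂ t =>
    exists_deriveR_eq P h1 hhB hδ hδK hd₁ hd₂ hk₁ hk₂ ha₁ ha₂ t

end CubicClassPost

end Literature.Computability.Cryptography

end
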